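import Summits.QuantumFields.YangMills.Theorems.BalabanUVNodesK1V9Defs

/-!
# K1 v9 LINE 2 (the `RecordSⱽ` slot class; plan g86) — THE WITNESS ADAPTERS AND ∃-SIDE PRODUCERS AT AN `RecordSⱽ` WORLD: LINE-2 twins of this seat's `K1V7RDefs` §3∕§4 (p617892) and
# `K1R8OfCeilingKeyedRung1` §1∕§2 (p620073), concluding the registered `stub_runRows13PWSV` ∕ `stub_cont13V` texts' rung `RunRowsContAtSomeRecord13PWSV F` and K1⁹ `StabilityBRunRowsAtRecordR13SepCoPHV` BY NAME

Cell `pub-ymgap`, WIDTH SEAT `pub-ymgap-dag-n24-w1` (gen 4; director-ym №197 ∕ HUMAN RULING D-0149).  `--kind proof --supports stmt-QuantumFields-27364 --as helper` (dag-lead KEY MAP v2; count-neutral).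
[I] = [Balaban1987RG1]; [II] = [Balaban1988RG2Cluster]; [III] = [Balaban1988Convergent]; [V] = [Balaban1989LargeFieldII].

WHY.  Route rev 28∕29 (chair R463, plan g85, 2026-08-28T09:54–09:56Z; director-ym №210 (δ)) made K1⁹ `StabilityBRunRowsAtRecordR13SepCoPHV` = stmt-QuantumFields-27364 the DECIDING crux: K1⁸ with
(B) asked of SOME revision `v : Node00.Revision₁₃ F 2 θ h` of the record's density tower (DEF-1 `Node00/Record13SepCoPHV` p620607; β, flow and `toB12` version-free by `rfl`).  Plan g86's
skeleton v9 = LINE 1 (v8's three stubs byte-identical — their tree mirror is `K1V6Defs` ∕ `K1V7RDefs`) ∪ LINE 2: the S-bound record class AT THE SLOT `RecordSⱽ F θ h v w` (= `RecordS` with the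
ONE clause `w.C = (Node00.datumOfRecord₁₃SepCoPHV F 2 θ h v).C`; dag-n13-w1 g5 LOCATED-2: LINE 1's `RecordS` pins the UNREVISED datum, under which N13's `uvBounds` leaf reads (2.50) pointwise
on the chosen densities), the rungs `NodesAtSomeRecord13PWSV` ∕ `RunRowsAtSomeRecord13PWSV` ∕ `RunRowsContAtSomeRecord13PWSV` and the stubs `stub_nodes13PWSV` ∕ `stub_runRows13PWSV` ∕
`stub_cont13V`.  DEF-1 g9's `Thm/BalabanUVNodesK1V9Defs.lean` (landed ≈11:20Z) mirrors those texts BY NAME and composes K1⁹ from them; dag-n13-w3 g4's `Thm/BalabanUVNodesK1R9BodyAtRevisedRecordWorldOfNodesRunLetters.lean` (p627483) lands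
the V-END road (this seat's p598782 §2 re-run at the revised datum).  THIS FILE re-keys every witness adapter and ∃-side producer of this seat's LINE-1 files to the slot class — the β-side rows
are θ-level and version-free, so every proof is the LINE-1 proof with `v` threaded and `RecordSⱽ` in place of `RecordS`: the level-matching in `stub_cont13V` is free (`survCont_anti`), ONE
`RunRemAt` letter pays `stub_runRows13PWSV` AND `stub_cont13V` at a slot witness, K0⁷ 3ᴬ′'s |β| box reduces the β-side to «(PS) + (C)», the ceiling-keyed rung-1ⱽ family removes the numeric
match, and K1⁹ follows BY NAME from ONE ∃-side producer on each currency.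

CONTENTS.  §1 `runRowsContVAt_of_runRowsVAt_of_survCont` (level-free junction at the slot) · `…_of_betaContH` · `runRowsContVAt_of_rung1VAt_of_absBox_of_runwisePS_of_survCont` ·
`runRowsContAtSomeRecord13PWSV_of_runRemAt_drift_match` (ONE run letter pays stubs 2ⱽ and 3ⱽ) · `…_of_remAt_drift_match`.  §2 `runRowsContVAt_of_ceilingKeyedRung1V_of_rows_of_survCont` ·
`…_of_runRemAt_drift` (NO match).  §3 `stabilityBRunRowsAtRecordR13SepCoPHV_of_rung1VWithRunRemAt` · `…_of_ceilingKeyedRung1VWithRunRemAt` · `…_of_ceilingKeyedRung1VWithBoundedRowsCont` (K1⁹ BY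
NAME from ONE ∃-side producer each, through DEF-1's `K1V9Defs.stabilityBRunRowsAtRecordR13SepCoPHV_of_rung0_runRowsContV` ∘ dag-n13-w3's V-END road).  NOT here (DEF-1's `K1V9Defs`, cited):
the rung projections, `stub_cont13V_of_cont13All`, the `_of_line1` doors, `…V_of_rung0_runRowsContV`, `…V_of_stubTextsV`.

HONEST FRAMING.  By-name glue and small adapters over displayed hypothesis shapes; NOTHING of Bałaban asserted; NO stub proved; nothing registered or re-registered; K0⁷ stmt-QuantumFields-20541 ∕
K1⁹ stmt-QuantumFields-27364 (DECIDING) ∕ K3⁸ stmt-QuantumFields-27366 OPEN; N24 COMPOSITE.  Counts unmoved (typed 28∕28 · discharged 5∕27 (A 5∕28)).  [I] §1 continuity and [B12] Thm 2 unproved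
in print.  One finite 𝕋⁴ programme at fixed `ε = L^{−K}`, Bałaban AS PRINTED — NOT continuum ∕ ℝ⁴ ∕ OS ∕ mass gap ∕ Clay: the Yang–Mills mass gap is NOT proved by any of this; route R4 closes the
CONDITIONAL finite-𝕋⁴ rung `BalabanLadder.UV` only.  No `sorry`, `instance`, `notation`; standard axioms.
-/

noncomputable section

open scoped Matrix.Norms.L2Operator

namespace Summit.QuantumFields.YangMills.Theorems.K1V9Adapters

open Literature.MathematicalPhysics.QuantumFieldTheory.Balaban1983to89
open Literature.MathematicalPhysics.QuantumFieldTheory.Balaban1983to89.T4Continuum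
open Literature.MathematicalPhysics.QuantumFieldTheory.Balaban1983to89.DagBinding
open FlowStepRuns
open FlowStep (HBeta RGEqH prefixOf BetaContH BetaLowerH BetaUpperH)
open Summit.QuantumFields.YangMills.Theorems.BalabanUVNodesK2NamedJetsRunRemAt (RunRemAt RunConstRemainder SurvCont runwisePS_of_drift_runConstRemainder runRemAt_of_remAt)
open Summit.QuantumFields.YangMills.Theorems.BalabanUVNodesK2NamedJetsRemAt (RemAt band_of_drift)
open Summit.QuantumFields.YangMills.Theorems.BalabanUVNodesK2JsOfRecord (StepColourData beta0OfJs)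
open Literature.MathematicalPhysics.QuantumFieldTheory.Balaban1983to89.Beta.Drift (OneLoopDrift)
open Summit.QuantumFields.YangMills.Theorems.EndpointGivenBR13SepCoPH.Negative.RemNamedJets13FalseOfTwoNormalisations (oneLoopDrift_const_mul)
open Summit.QuantumFields.YangMills.BalabanUVNodes.N17RunRemAtOfShiftAnchorLevel (survCont_anti)
open Summit.QuantumFields.YangMills.BalabanUVNodes.K1RunRowsOfBoxAndPartialSums (runConstRemainder_of_twoSided_alongRuns runConstRemainder_of_boxBounds
  runwisePS_of_lower_alongRuns_nonneg bounds_alongRGEqH_of_betaBoundsInInterval)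
open Summit.QuantumFields.YangMills.Theorems.K1V6Defs (RecordS Inhabited13 NodesAtSomeRecord13PWS RunRowsAtSomeRecord13PWS Window)
open Summit.QuantumFields.YangMills.Theorems.K1V7RDefs (RunRowsContAtSomeRecord13PWS)
open Summit.QuantumFields.YangMills.Theorems.BalabanUVNodesK1R8RowsDefs (Cont13All)
open Summit.QuantumFields.YangMills.Theorems.K1V9Defs (RecordSV NodesAtSomeRecord13PWSV RunRowsAtSomeRecord13PWSV RunRowsContAtSomeRecord13PWSV
  stabilityBRunRowsAtRecordR13SepCoPHV_of_rung0_runRowsContV)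

/-! ## §1 Witness-level adapters at an `RecordSⱽ` world (LINE-2 twins of `K1V7RDefs` §3): the level-matching in stub 3ⱽ is free; ONE run letter pays stubs 2ⱽ and 3ⱽ -/

section Witness

variable {F : T4Family}

/-- **★ THE LEVEL-FREE JUNCTION AT THE SLOT**: at rung-1ⱽ data `(θ, h, v, w)` (unity ∧ slots, admissibility, an S-bound world of the REVISED datum `datumOfRecord₁₃SepCoPHV θ h v` with the
thirteen nodes at every run), the rows (i)–(iv) of `β_θ` at SOME level `γ₀ > 0` AND `SurvCont β_θ γc` at ANY level `γc > 0` give rung 2ⱽ‴ at the level `min γ₀ γc` (`RunConstRemainder.mono`,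
floor restricted, dag-n17-w1's `survCont_anti`).  = `K1V7RDefs.runRowsContAt_of_runRowsAt_of_survCont` with the slot threaded (β is θ-level, version-free).
[cite: Balaban1987RG1, Thm 3 p.264, (1.22) p.264, §1 pp.263–264 (bookkeeping)] -/
theorem runRowsContVAt_of_runRowsVAt_of_survCont (θ : Node00.Stage13HParams F 2) (h : θ.Provisos₁₃SepCoPH F 2) (v : Node00.Revision₁₃ F 2 θ h) (w : WorldP)
    (hU : θ.ZhUnity F 2 ∧ θ.SlotsNondegenerate₁₃ F 2) (hθ : θ.Admissible F 2) (hR : RecordSV F θ h v w) (hnodes : ∀ P : B12.RunParams, Nodes (leavesP w P))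
    {b : ℕ → ℝ} {r γ₀ B M : ℝ} (hγ₀ : 0 < γ₀) (hrem : RunConstRemainder (Node00.betaOfRecord₁₃ F 2 θ.toStage13Params) b r γ₀) (hB : ∀ k, b k ≤ B) (hmatch : B + r ≤ w.βup)
    (hps : ∀ (n : ℕ) (gs : ℕ → ℝ), RGEqH n (Node00.betaOfRecord₁₃ F 2 θ.toStage13Params) gs → Step.InInterval γ₀ n gs →
      ∀ k, k ≤ n → -M ≤ ∑ j ∈ Finset.Ico k n, Node00.betaOfRecord₁₃ F 2 θ.toStage13Params j (prefixOf gs j))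
    {γc : ℝ} (hγc : 0 < γc) (hsc : SurvCont (Node00.betaOfRecord₁₃ F 2 θ.toStage13Params) γc) : RunRowsContAtSomeRecord13PWSV F := by
  refine ⟨θ, h, v, w, hU, hθ, hR, hnodes, b, r, min γ₀ γc, B, M, lt_min hγ₀ hγc, hrem.mono (min_le_left _ _), hB, hmatch, ?_,
    survCont_anti (lt_min hγ₀ hγc) (min_le_right _ _) hsc⟩
  intro n gs hrg hI k hk
  exact hps n gs hrg (fun j hj => ⟨(hI j hj).1, (hI j hj).2.trans (min_le_left _ _)⟩) k hk

/-- The same junction with the BOX continuity letter `BetaContH γc β_θ` in place of `SurvCont` (DEF-1's `SurvCont.of_betaContH`). [cite: Balaban1987RG1, §1 pp.263–264 (bookkeeping)] -/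
theorem runRowsContVAt_of_runRowsVAt_of_betaContH (θ : Node00.Stage13HParams F 2) (h : θ.Provisos₁₃SepCoPH F 2) (v : Node00.Revision₁₃ F 2 θ h) (w : WorldP)
    (hU : θ.ZhUnity F 2 ∧ θ.SlotsNondegenerate₁₃ F 2) (hθ : θ.Admissible F 2) (hR : RecordSV F θ h v w) (hnodes : ∀ P : B12.RunParams, Nodes (leavesP w P))
    {b : ℕ → ℝ} {r γ₀ B M : ℝ} (hγ₀ : 0 < γ₀) (hrem : RunConstRemainder (Node00.betaOfRecord₁₃ F 2 θ.toStage13Params) b r γ₀) (hB : ∀ k, b k ≤ B) (hmatch : B + r ≤ w.βup)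
    (hps : ∀ (n : ℕ) (gs : ℕ → ℝ), RGEqH n (Node00.betaOfRecord₁₃ F 2 θ.toStage13Params) gs → Step.InInterval γ₀ n gs →
      ∀ k, k ≤ n → -M ≤ ∑ j ∈ Finset.Ico k n, Node00.betaOfRecord₁₃ F 2 θ.toStage13Params j (prefixOf gs j))
    {γc : ℝ} (hγc : 0 < γc) (hcont : BetaContH γc (Node00.betaOfRecord₁₃ F 2 θ.toStage13Params)) : RunRowsContAtSomeRecord13PWSV F :=
  runRowsContVAt_of_runRowsVAt_of_survCont θ h v w hU hθ hR hnodes hγ₀ hrem hB hmatch hps hγc (SurvCont.of_betaContH hγc hcont)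

/-- **AT A SLOT WITNESS CARRYING A SIGN-FREE |β| BOX, LINE 2's β-SIDE STUB PAIR IS «(PS) FLOOR + (C)»**: rung-1ⱽ data + `BetaLowerH (−β′) γ₀ β_θ ∧ BetaUpperH β′ γ₀ β_θ` (K0⁷ 3ᴬ′'s currency) +
`β′ ≤ w.βup` + run-wise (PS) with defect `M` + `SurvCont β_θ γc` at ANY level ⊢ rung 2ⱽ‴ (`b :≡ 0`, `r := β′`, `B := 0`).  = `K1V7RDefs.runRowsContAt_of_rung1At_of_absBox_of_runwisePS_of_survCont`
at the slot. [cite: Balaban1987RG1, §1 (1.22) p.264, Thm 2 p.259, Thm 3 p.264, §1 pp.263–264; Balaban1988RG2Cluster, (2.41) p.21 (bookkeeping)] -/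
theorem runRowsContVAt_of_rung1VAt_of_absBox_of_runwisePS_of_survCont (θ : Node00.Stage13HParams F 2) (h : θ.Provisos₁₃SepCoPH F 2) (v : Node00.Revision₁₃ F 2 θ h) (w : WorldP)
    (hU : θ.ZhUnity F 2 ∧ θ.SlotsNondegenerate₁₃ F 2) (hθ : θ.Admissible F 2) (hR : RecordSV F θ h v w) (hnodes : ∀ P : B12.RunParams, Nodes (leavesP w P))
    {γ₀ β' M : ℝ} (hγ₀ : 0 < γ₀) (hlow : BetaLowerH (-β') γ₀ (Node00.betaOfRecord₁₃ F 2 θ.toStage13Params)) (hup : BetaUpperH β' γ₀ (Node00.betaOfRecord₁₃ F 2 θ.toStage13Params))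
    (hmatch : β' ≤ w.βup)
    (hps : ∀ (n : ℕ) (gs : ℕ → ℝ), RGEqH n (Node00.betaOfRecord₁₃ F 2 θ.toStage13Params) gs → Step.InInterval γ₀ n gs →
      ∀ k, k ≤ n → -M ≤ ∑ j ∈ Finset.Ico k n, Node00.betaOfRecord₁₃ F 2 θ.toStage13Params j (prefixOf gs j))
    {γc : ℝ} (hγc : 0 < γc) (hsc : SurvCont (Node00.betaOfRecord₁₃ F 2 θ.toStage13Params) γc) : RunRowsContAtSomeRecord13PWSV F := by
  have hrem := runConstRemainder_of_boxBounds hlow hup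
  have e1 : (-β' + β') / 2 = (0 : ℝ) := by ring
  have e2 : (β' - -β') / 2 = β' := by ring
  rw [e1, e2] at hrem
  exact runRowsContVAt_of_runRowsVAt_of_survCont θ h v w hU hθ hR hnodes (B := 0) hγ₀ hrem (fun _ => le_rfl) (by linarith) hps hγc hsc

/-- **★ ONE RUN LETTER PAYS STUBS 2ⱽ AND 3ⱽ**: at rung-1ⱽ data, ym-nodeO DEF-1's `RunRemAt F κ θ h c` (run-wise constant remainder of the datum's `βfun` = `β_θ` relative to `c • beta0OfJs F κ`
with cap, box anchor UNREAD, `SurvCont D.βfun γ₀`) + the bare drift + the numeric match `2c·stepBal 2 F.L + 2|c|A ≤ w.βup` ⊢ rung 2ⱽ‴ at the letter's own level.  The letter is keyed at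
`(θ, h)` only — the slot `v` rides with the world.  = `K1V7RDefs.runRowsContAtSomeRecord13PWS_of_runRemAt_drift_match` at the slot.
[cite: Balaban1987RG1, Thm 3 p.264, (1.20)–(1.22) p.264, (2.12)–(2.14) p.268, (5.10) p.293, §1 pp.263–264 (bookkeeping)] -/
theorem runRowsContAtSomeRecord13PWSV_of_runRemAt_drift_match (θ : Node00.Stage13HParams F 2) (h : θ.Provisos₁₃SepCoPH F 2) (v : Node00.Revision₁₃ F 2 θ h) (w : WorldP)
    (hU : θ.ZhUnity F 2 ∧ θ.SlotsNondegenerate₁₃ F 2) (hθ : θ.Admissible F 2) (hR : RecordSV F θ h v w) (hnodes : ∀ P : B12.RunParams, Nodes (leavesP w P))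
    (κ : StepColourData) {c A : ℝ} (hRun : RunRemAt F κ θ h c) (hdrift : OneLoopDrift (B12Normalization.stepBal 2 F.L) A (beta0OfJs F κ))
    (hmatch : 2 * (c * B12Normalization.stepBal 2 F.L) + 2 * (|c| * A) ≤ w.βup) : RunRowsContAtSomeRecord13PWSV F := by
  obtain ⟨γ₀, s, hγ₀, -, hcap, hrem, -, hsc⟩ := hRun
  have hd := oneLoopDrift_const_mul hdrift c
  have hband : ∀ k, c * beta0OfJs F κ k ≤ c * B12Normalization.stepBal 2 F.L + 2 * (|c| * A) := fun k => by
    have := (abs_le.mp (band_of_drift hd k)).2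
    linarith
  have hmatch' : c * B12Normalization.stepBal 2 F.L + 2 * (|c| * A) + s ≤ w.βup := by linarith
  exact ⟨θ, h, v, w, hU, hθ, hR, hnodes, fun k => c * beta0OfJs F κ k, s, γ₀, _, _, hγ₀, hrem, hband, hmatch', runwisePS_of_drift_runConstRemainder hd hrem hcap, hsc⟩

/-- … and with ed.3's BOX letter `RemAt F κ θ h c` (via DEF-1's `runRemAt_of_remAt`). [cite: Balaban1987RG1, (1.20)–(1.22) p.264, (2.12)–(2.14) p.268 (bookkeeping)] -/
theorem runRowsContAtSomeRecord13PWSV_of_remAt_drift_match (θ : Node00.Stage13HParams F 2) (h : θ.Provisos₁₃SepCoPH F 2) (v : Node00.Revision₁₃ F 2 θ h) (w : WorldP)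
    (hU : θ.ZhUnity F 2 ∧ θ.SlotsNondegenerate₁₃ F 2) (hθ : θ.Admissible F 2) (hR : RecordSV F θ h v w) (hnodes : ∀ P : B12.RunParams, Nodes (leavesP w P))
    (κ : StepColourData) {c A : ℝ} (hRem : RemAt F κ θ h c) (hdrift : OneLoopDrift (B12Normalization.stepBal 2 F.L) A (beta0OfJs F κ))
    (hmatch : 2 * (c * B12Normalization.stepBal 2 F.L) + 2 * (|c| * A) ≤ w.βup) : RunRowsContAtSomeRecord13PWSV F :=
  runRowsContAtSomeRecord13PWSV_of_runRemAt_drift_match θ h v w hU hθ hR hnodes κ (runRemAt_of_remAt F κ θ h hRem) hdrift hmatch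

/-! ## §2 The CEILING-KEYED rung-1ⱽ bridges (LINE-2 twins of `K1R8OfCeilingKeyedRung1` §1): the match discharged by choosing the world after the rows, at a fixed revision -/

/-- **THE CEILING-KEYED BRIDGE INTO RUNG 2ⱽ‴**: from a ceiling-keyed family of S-bound worlds of ONE revised datum `datumOfRecord₁₃SepCoPHV θ h v` — `∀ c, ∃ w, c ≤ w.βup ∧ RecordSV F θ h v w ∧
∀ P, Nodes (leavesP w P)` (N11 with `β′` a parameter; the world keyed AFTER the ceiling) — and the MATCH-FREE bounded rows + (C) at any level: rung 2ⱽ‴ (world at `c := B + r`).  Whether the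
rung-1ⱽ lanes can export such a family is their question, NOT claimed. [cite: Balaban1988Convergent, Thm 1 p.262, p.255; Balaban1987RG1, Thm 3 p.264, §1 pp.263–264 (bookkeeping)] -/
theorem runRowsContVAt_of_ceilingKeyedRung1V_of_rows_of_survCont (θ : Node00.Stage13HParams F 2) (h : θ.Provisos₁₃SepCoPH F 2) (v : Node00.Revision₁₃ F 2 θ h)
    (hU : θ.ZhUnity F 2 ∧ θ.SlotsNondegenerate₁₃ F 2) (hθ : θ.Admissible F 2)
    (hfam : ∀ c : ℝ, ∃ w : WorldP, c ≤ w.βup ∧ RecordSV F θ h v w ∧ ∀ P : B12.RunParams, Nodes (leavesP w P))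
    {b : ℕ → ℝ} {r γ₀ B M : ℝ} (hγ₀ : 0 < γ₀) (hrem : RunConstRemainder (Node00.betaOfRecord₁₃ F 2 θ.toStage13Params) b r γ₀) (hB : ∀ k, b k ≤ B)
    (hps : ∀ (n : ℕ) (gs : ℕ → ℝ), RGEqH n (Node00.betaOfRecord₁₃ F 2 θ.toStage13Params) gs → Step.InInterval γ₀ n gs →
      ∀ k, k ≤ n → -M ≤ ∑ j ∈ Finset.Ico k n, Node00.betaOfRecord₁₃ F 2 θ.toStage13Params j (prefixOf gs j))
    {γc : ℝ} (hγc : 0 < γc) (hsc : SurvCont (Node00.betaOfRecord₁₃ F 2 θ.toStage13Params) γc) : RunRowsContAtSomeRecord13PWSV F := by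
  obtain ⟨w, hc, hR, hnodes⟩ := hfam (B + r)
  exact runRowsContVAt_of_runRowsVAt_of_survCont θ h v w hU hθ hR hnodes hγ₀ hrem hB hc hps hγc hsc

/-- **THE CEILING-KEYED BRIDGE AT THE SLOT ON THE 2ᴮ″ CURRENCY — NO MATCH**: ceiling-keyed rung-1ⱽ data + ONE `RunRemAt F κ θ h c` + the bare drift ⊢ rung 2ⱽ‴ (world requested at
`c·stepBal 2 F.L + 2|c|A + s`). [cite: Balaban1987RG1, Thm 3 p.264, (1.20)–(1.22) p.264, (2.12)–(2.14) p.268, §1 pp.263–264 (bookkeeping)] -/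
theorem runRowsContVAt_of_ceilingKeyedRung1V_of_runRemAt_drift (θ : Node00.Stage13HParams F 2) (h : θ.Provisos₁₃SepCoPH F 2) (v : Node00.Revision₁₃ F 2 θ h)
    (hU : θ.ZhUnity F 2 ∧ θ.SlotsNondegenerate₁₃ F 2) (hθ : θ.Admissible F 2)
    (hfam : ∀ c : ℝ, ∃ w : WorldP, c ≤ w.βup ∧ RecordSV F θ h v w ∧ ∀ P : B12.RunParams, Nodes (leavesP w P))
    (κ : StepColourData) {c A : ℝ} (hRun : RunRemAt F κ θ h c) (hdrift : OneLoopDrift (B12Normalization.stepBal 2 F.L) A (beta0OfJs F κ)) :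
    RunRowsContAtSomeRecord13PWSV F := by
  obtain ⟨γ₀, s, hγ₀, -, hcap, hrem, -, hsc⟩ := hRun
  have hd := oneLoopDrift_const_mul hdrift c
  have hband : ∀ k, c * beta0OfJs F κ k ≤ c * B12Normalization.stepBal 2 F.L + 2 * (|c| * A) := fun k => by
    have := (abs_le.mp (band_of_drift hd k)).2
    linarith
  exact runRowsContVAt_of_ceilingKeyedRung1V_of_rows_of_survCont θ h v hU hθ hfam hγ₀ hrem hband (runwisePS_of_drift_runConstRemainder hd hrem hcap) hγ₀ hsc

end Witness

/-! ## §3 The ∃-side producers of K1⁹ BY NAME (LINE-2 twins of `K1V7RDefs` §4 ∕ `K1R8OfCeilingKeyedRung1` §2) -/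

section Producers

/-- **★ K1⁹ BY NAME FROM ONE ∃-SIDE PRODUCER «RUNG 1ⱽ WITH THE RUN LETTER AT THE WITNESS»**: for every family with a unity Stage-13 tuple, SOME `(θ, h)`, SOME revision `v` of its record tower,
at SOME scale the run letter `RunRemAt F κ θ h c` with the bare drift, and an S-bound world of the REVISED datum whose ceiling clears `2c·stepBal 2 F.L + 2|c|A` with the thirteen nodes at every
run.  Conclusion = `…Theses.BalabanUVNodes.StabilityBRunRowsAtRecordR13SepCoPHV` literally.  CONDITIONAL on `h`; K1⁹ NOT closed by this theorem; nothing of Bałaban asserted.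
[cite: Balaban1989LargeFieldII, Thm 1 p.355 + (0.1) pp.355–356; Balaban1987RG1, Thm 2 p.259, Thm 3 p.264, (1.20)–(1.22) p.264, (2.12)–(2.14) p.268, §1 pp.263–264; Balaban1988Convergent, (2.6) p.255, Cor. 3 (2.50) p.264, (2.18) p.257 (bookkeeping)] -/
theorem stabilityBRunRowsAtRecordR13SepCoPHV_of_rung1VWithRunRemAt
    (h : ∀ F : T4Family, Inhabited13 F →
      ∃ (θ : Node00.Stage13HParams F 2) (h : θ.Provisos₁₃SepCoPH F 2) (v : Node00.Revision₁₃ F 2 θ h), (θ.ZhUnity F 2 ∧ θ.SlotsNondegenerate₁₃ F 2) ∧ θ.Admissible F 2 ∧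
        ∃ (κ : StepColourData) (c A : ℝ), RunRemAt F κ θ h c ∧ OneLoopDrift (B12Normalization.stepBal 2 F.L) A (beta0OfJs F κ) ∧
          ∃ w : WorldP, 2 * (c * B12Normalization.stepBal 2 F.L) + 2 * (|c| * A) ≤ w.βup ∧ RecordSV F θ h v w ∧ ∀ P : B12.RunParams, Nodes (leavesP w P)) :
    Summit.QuantumFields.YangMills.Theses.BalabanUVNodes.StabilityBRunRowsAtRecordR13SepCoPHV :=
  stabilityBRunRowsAtRecordR13SepCoPHV_of_rung0_runRowsContV fun F hinh => by
    obtain ⟨θ, hP, v, hU, hθ, κ, c, A, hRun, hdrift, w, hmatch, hR, hnodes⟩ := h F hinh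
    exact runRowsContAtSomeRecord13PWSV_of_runRemAt_drift_match θ hP v w hU hθ hR hnodes κ hRun hdrift hmatch

/-- **★ K1⁹ BY NAME, MATCH-FREE, FROM «CEILING-KEYED RUNG 1ⱽ + THE RUN LETTER»** — the β-side input is exactly K2⁷'s 2ᴮ″ pair «`RunRemAt` + drift» at the K1 tuple; NO numeric match.
CONDITIONAL on `h`; K1⁹ NOT closed by this theorem. [cite: Balaban1989LargeFieldII, Thm 1 p.355; Balaban1988Convergent, Thm 1 p.262, (2.18) p.257; Balaban1987RG1, Thm 3 p.264, (1.20)–(1.22) p.264, §1 pp.263–264 (bookkeeping)] -/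
theorem stabilityBRunRowsAtRecordR13SepCoPHV_of_ceilingKeyedRung1VWithRunRemAt
    (h : ∀ F : T4Family, Inhabited13 F →
      ∃ (θ : Node00.Stage13HParams F 2) (h : θ.Provisos₁₃SepCoPH F 2) (v : Node00.Revision₁₃ F 2 θ h), (θ.ZhUnity F 2 ∧ θ.SlotsNondegenerate₁₃ F 2) ∧ θ.Admissible F 2 ∧
        (∀ c : ℝ, ∃ w : WorldP, c ≤ w.βup ∧ RecordSV F θ h v w ∧ ∀ P : B12.RunParams, Nodes (leavesP w P)) ∧
        ∃ (κ : StepColourData) (c A : ℝ), RunRemAt F κ θ h c ∧ OneLoopDrift (B12Normalization.stepBal 2 F.L) A (beta0OfJs F κ)) :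
    Summit.QuantumFields.YangMills.Theses.BalabanUVNodes.StabilityBRunRowsAtRecordR13SepCoPHV :=
  stabilityBRunRowsAtRecordR13SepCoPHV_of_rung0_runRowsContV fun F hinh => by
    obtain ⟨θ, hP, v, hU, hθ, hfam, κ, c, A, hRun, hdrift⟩ := h F hinh
    exact runRowsContVAt_of_ceilingKeyedRung1V_of_runRemAt_drift θ hP v hU hθ hfam κ hRun hdrift

/-- **K1⁹ BY NAME, MATCH-FREE, ON THE GENERIC ROWS CURRENCY**: ceiling-keyed rung 1ⱽ + the match-free bounded rows (i)(ii)(iv) + (C) on one level, at SOME revision.  CONDITIONAL; K1⁹ NOT closed.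
[cite: Balaban1989LargeFieldII, Thm 1 p.355; Balaban1988Convergent, Thm 1 p.262; Balaban1987RG1, Thm 3 p.264, (5.10) p.293, §1 pp.263–264 (bookkeeping)] -/
theorem stabilityBRunRowsAtRecordR13SepCoPHV_of_ceilingKeyedRung1VWithBoundedRowsCont
    (h : ∀ F : T4Family, Inhabited13 F →
      ∃ (θ : Node00.Stage13HParams F 2) (h : θ.Provisos₁₃SepCoPH F 2) (v : Node00.Revision₁₃ F 2 θ h), (θ.ZhUnity F 2 ∧ θ.SlotsNondegenerate₁₃ F 2) ∧ θ.Admissible F 2 ∧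
        (∀ c : ℝ, ∃ w : WorldP, c ≤ w.βup ∧ RecordSV F θ h v w ∧ ∀ P : B12.RunParams, Nodes (leavesP w P)) ∧
        ∃ (b : ℕ → ℝ) (r γ₀ B M : ℝ), 0 < γ₀ ∧ RunConstRemainder (Node00.betaOfRecord₁₃ F 2 θ.toStage13Params) b r γ₀ ∧ (∀ k, b k ≤ B) ∧
          (∀ (n : ℕ) (gs : ℕ → ℝ), RGEqH n (Node00.betaOfRecord₁₃ F 2 θ.toStage13Params) gs → Step.InInterval γ₀ n gs →
            ∀ k, k ≤ n → -M ≤ ∑ j ∈ Finset.Ico k n, Node00.betaOfRecord₁₃ F 2 θ.toStage13Params j (prefixOf gs j)) ∧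
          SurvCont (Node00.betaOfRecord₁₃ F 2 θ.toStage13Params) γ₀) :
    Summit.QuantumFields.YangMills.Theses.BalabanUVNodes.StabilityBRunRowsAtRecordR13SepCoPHV :=
  stabilityBRunRowsAtRecordR13SepCoPHV_of_rung0_runRowsContV fun F hinh => by
    obtain ⟨θ, hP, v, hU, hθ, hfam, b, r, γ₀, B, M, hγ₀, hrem, hB, hps, hsc⟩ := h F hinh
    exact runRowsContVAt_of_ceilingKeyedRung1V_of_rows_of_survCont θ hP v hU hθ hfam hγ₀ hrem hB hps hγ₀ hsc

end Producers

end Summit.QuantumFields.YangMills.Theorems.K1V9Adapters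

end
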